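import Summits.BirchSwinnertonDyer.BirchSwinnertonDyer.Theorems.ManinLocalTwoThreeCDivisionFullTwoTorsion
import Summits.BirchSwinnertonDyer.BirchSwinnertonDyer.Theorems.ManinLocalTwoThreeCDivisionOddSquarefreeResidual
import Summits.BirchSwinnertonDyer.BirchSwinnertonDyer.Theorems.ManinLocalTwoThreeCDivisionNeronPeriodsConsumers
import HarnessLib

/-!
# C2 `ManinOddAtFour` ⟸ CDT ∧ E-an-152e ∧ the anchor hypothesis (E-an-152d replaced by a kernel theorem)
(route `ManinLocalTwoThree`, crux C2 `ManinOddAtFour` stmt-BirchSwinnertonDyer-22967; cell bsd-f2-manin, prover p3 gen 19)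

The line of record `cdivision_udc` reduces C2, in the kernel, to the printed CDT fact plus E-an-152c; -an g45 split 152c ⟸ 152d ∧ 152e
(`CDivisionNeron.maninOddAtFour_of_CDT_freyHabitat`, both rows `@[conjecture]`).  Here 152d is REPLACED by the kernel theorem
`CDivTranslate.exists_three_hasRationalTwoTorsionX_of_indexFour_of_anchor` (index `4` ∧ `|c₀| = 2` ⟹ full rational `2`-torsion, given the anchor
hypothesis on sign characters of `Γ₀(N)`):
* `maninOddAtFour_of_CDT_anchor_freyHabitat` — **C2 ⟸ CDT ∧ (anchors at every level) ∧ E-an-152e `ShimuraIndexNeFourAtFourFreyHabitat`**: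
  at a level with an odd square, `|c₀| = 1` (LEAD's `CDivisionUDC.not_two_dvd_maninConstant_of_CDT_of_odd_sq_dvd`); otherwise `2 ∣ c₀` forces
  `|c₀| = 2` (`natAbs_maninConstant_le_two_of_CDT`) and the index-`4` configuration (`CDivision.indexFour_of_cDivisionWitness_of_UDW`), hence three
  rational `2`-torsion abscissae, which E-an-152e excludes.
HONEST FRAMING: CONDITIONAL on the printed CDT fact, on the anchor hypothesis (classical: `η`-quotients with quadratic character; discharged in a sequel)
and on the OPEN row E-an-152e; C2 as filed, Manin's conjecture and BSD are NOT proved here.  No definitions, no sorry.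
[cite: CalegariDimitrovTang2025, Thm. 1.0.1] [cite: LingOesterle1991, Thm. 6] [cite: Stevens1989, §2]
-/

set_option autoImplicit false
-- lint-debt: the directory name repeats the summit name (sibling precedent `ManinLocalTwoThreeCDivisionFullTwoTorsion.lean`)
set_option linter.dupNamespace false

noncomputable section

open scoped Topology PeriodPair MatrixGroups ModularForm Manifold Classical
open Complex Filter PowerSeries CongruenceSubgroup
open UpperHalfPlane hiding I
open WeierstrassCurve Literature.NumberTheory.EllipticCurves Literature.NumberTheory.EllipticCurves.ModularForms
open Summit.BirchSwinnertonDyer.Rank1Residual.ManinAdditive.UDCKummerLineK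

namespace Summit.BirchSwinnertonDyer.BirchSwinnertonDyer.Theorems.ManinLocalTwoThree.CDivTranslate

/-- **C2 `ManinOddAtFour` ⟸ CDT ∧ (anchor forms at every level) ∧ E-an-152e.**  CONDITIONAL; see the module docstring.
[cite: CalegariDimitrovTang2025, Thm. 1.0.1] [cite: LingOesterle1991, Thm. 6] [cite: Stevens1989, §2] -/
theorem maninOddAtFour_of_CDT_anchor_freyHabitat
    (hCDT : Literature.NumberTheory.Automorphic.CalegariDimitrovTang2025_unboundedDenominators_algInt)
    (hAnchor : ∀ (N : ℕ) [NeZero N], ∀ χ : SL(2, ℤ) → ℤ,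
      (∀ γ ∈ Gamma0 N, χ γ = 1 ∨ χ γ = -1) → (∀ γ ∈ Gamma0 N, ∀ δ ∈ Gamma0 N, χ (γ * δ) = χ γ * χ δ) →
      (∀ γ ∈ Gamma0 N, ((γ 1 1 : ℤ) : ZMod N) = 1 → χ γ = 1) → (∀ γ ∈ Gamma0 N, γ 1 0 = 0 → χ γ = 1) →
      ∃ (N' : ℕ) (kg : ℤ) (g : ℍ → ℂ) (cg : ℕ → ℚ), N ∣ N' ∧ 0 < N' ∧ MDifferentiable 𝓘(ℂ) 𝓘(ℂ) g ∧
        (∀ δ : SL(2, ℤ), IsBoundedAtImInfty (g ∣[kg] δ)) ∧ (∀ γ ∈ Gamma0 N', g ∣[kg] γ = ((χ γ : ℤ) : ℂ) • g) ∧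
        (∀ τ : ℍ, HasSum (fun n : ℕ ↦ ((cg n : ℚ) : ℂ) * Function.Periodic.qParam 1 (τ : ℂ) ^ n) (g τ)) ∧ (∀ τ : ℍ, g τ ≠ 0))
    (he : CDivisionNeron.ShimuraIndexNeFourAtFourFreyHabitat) :
    Summit.BirchSwinnertonDyer.BirchSwinnertonDyer.Theses.ManinLocalTwoThree.ManinOddAtFour := by
  intro _hM _hAU _hC _hnf W _ _ N _ D hopt h4
  by_cases hsq : ∃ p : ℕ, p.Prime ∧ 3 ≤ p ∧ p ^ 2 ∣ N
  · obtain ⟨p, hp, h3, hpN⟩ := hsq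
    exact CDivisionUDC.not_two_dvd_maninConstant_of_CDT_of_odd_sq_dvd hCDT D hopt hp h3 hpN
  · intro h2c
    simp only [not_exists, not_and] at hsq
    obtain ⟨k, F, hhol, hinv, hstab, hgrowth, hq⟩ := CDivAssembly.exists_cDivisionWitness W D
    have hidx := CDivision.indexFour_of_cDivisionWitness_of_UDW D hopt h4 h2c
      (UDWOfCDT.unboundedDenominatorsWeightAlgInt_of_CDT_algInt hCDT k) hhol hinv hstab hgrowth hq
    have hle2 := CDivisionUDC.natAbs_maninConstant_le_two_of_CDT hCDT D h4 hopt
    have hc0 : D.c ≠ 0 := D.maninConstant_ne_zero_holds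
    have hc2 : D.c.natAbs = 2 := by
      have hdvd : 2 ∣ D.c.natAbs := by
        have := Int.natAbs_dvd_natAbs.mpr h2c
        simpa [ModularParametrizationData.maninConstant] using this
      have hne : D.c.natAbs ≠ 0 := Int.natAbs_ne_zero.mpr hc0
      have hle : D.c.natAbs ≤ 2 := by simpa [ModularParametrizationData.maninConstant] using hle2
      omega
    obtain ⟨x₁, x₂, x₃, h12, h13, h23, hx₁, hx₂, hx₃⟩ :=
      exists_three_hasRationalTwoTorsionX_of_indexFour_of_anchor D hopt hc2 hidx (hAnchor N)
    exact he W D hopt h4 (fun p hp h3 ↦ hsq p hp h3) ⟨x₁, x₂, x₃, h12, h13, h23, hx₁, hx₂, hx₃⟩ hidx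

end Summit.BirchSwinnertonDyer.BirchSwinnertonDyer.Theorems.ManinLocalTwoThree.CDivTranslate

end
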